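import Mathlib
import Literature.Analysis.ODE.SchrodingerODE

/-!
# Crux `UniformPhotonSphereChannelsR` (K1R, stmt-FinalStateConjecture-14074), line
# `crum-peeling-recessive-tower` — stub E (`stub_ladderExists`), helper 1: Riccati trap and dominant seed

Support file (pure real analysis / ODE, no definitions) for `stub_ladderExists` — existence of the
recessive Riccati/Crum ladder of the Regge–Wheeler potential.

* `riccati_trap`.  For a positive solution `v` of `v'' = V v` with `x² V(x) → L = α(α − 1)`
  (`α > 1`) the logarithmic derivative `η = x v'/v` satisfies the radial Riccati equation
  `x η' = η + x² V − η²`; its frozen right-hand side `η − η² + L = −(η − α)(η + α − 1)` has, as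
  `x → +∞`, the attracting root `α` and the repelling root `1 − α < 0`.  Every solution of
  `x η' = η + g − η²` (`g → α(α−1)`) which stays `≥ 0` converges to `α`.  Proof: for `δ > 0` and
  `x` large, `x η' ≤ −c < 0` wherever `η ≥ α + δ` and `x η' ≥ c > 0` wherever `0 ≤ η ≤ α − δ`;
  hence `η` enters the band `[α − δ, α + δ]` after a finite logarithmic time (comparison with
  `c log x`) and never leaves it (barrier, Mathlib's `image_le_of_deriv_right_lt_deriv_boundary`).
* `exists_dominant_seed` (registered form `ladderExists_dominantSeed`).  For `V ≥ 0` continuous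
  with `x² V → α(α−1)`, `α > 1`, the global solution of `v'' = V v`, `v(1) = 1`, `v'(1) = 0`
  (`Literature.Analysis.ODE.exists_isSchrodingerSol`) never vanishes — `(v v')' = v'² + V v² ≥ 0`
  makes `v²` monotone away from `x = 1`, so `v² ≥ 1` — and is DOMINANT at `+∞`: `x v'/v → α`
  (`riccati_trap`, as `x v'/v ≥ 0` on `[1, ∞)`).
Elementary; replaces the asymptotic integration of Hartman, *Ordinary Differential Equations*,
Ch. XI §9 for this qualitative statement.
-/

-- `Summit.<S>.<S>` repeats a namespace component by design (D-0017); off here as in the lakefile.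
set_option linter.dupNamespace false

namespace Summit.FinalStateConjecture.FinalStateConjecture.Theorems.CrumPeelingRecessiveTower

open Filter Set Topology Literature.Analysis.ODE
/-- Frozen Riccati field above the attracting root: for `η ≥ α + δ` (`α > 1`, `δ > 0`),
`η − η² + α(α−1) ≤ −δ(2α − 1 + δ)` (the value at `α + δ`). [folklore] -/
theorem riccati_field_le {α δ η : ℝ} (hα : 1 < α) (hδ : 0 < δ) (hη : α + δ ≤ η) :
    η - η ^ 2 + α * (α - 1) ≤ -(δ * (2 * α - 1 + δ)) := by
  nlinarith [mul_nonneg (sub_nonneg.2 hη) (by linarith : (0:ℝ) ≤ η + α + δ - 1)]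

/-- Frozen Riccati field below the attracting root: for `0 ≤ η ≤ α − δ` with `0 < δ ≤ α − 1`,
`η − η² + α(α−1) ≥ min (α(α−1)) (δ(2α − 1 − δ))`. [folklore] -/
theorem riccati_field_ge {α δ η : ℝ} (hδα : δ ≤ α - 1) (hη0 : 0 ≤ η) (hη : η ≤ α - δ) :
    min (α * (α - 1)) (δ * (2 * α - 1 - δ)) ≤ η - η ^ 2 + α * (α - 1) := by
  rcases le_total η 1 with h1 | h1
  · have : 0 ≤ η * (1 - η) := mul_nonneg hη0 (by linarith)
    calc min (α * (α - 1)) (δ * (2 * α - 1 - δ)) ≤ α * (α - 1) := min_le_left _ _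
      _ ≤ η - η ^ 2 + α * (α - 1) := by nlinarith
  · have : 0 ≤ (α - δ - η) * (α - δ + η - 1) := mul_nonneg (by linarith) (by linarith)
    calc min (α * (α - 1)) (δ * (2 * α - 1 - δ)) ≤ δ * (2 * α - 1 - δ) := min_le_right _ _
      _ ≤ η - η ^ 2 + α * (α - 1) := by nlinarith

/-- **Upper trap.** If `x η' = η + g − η²` on `[X, ∞)` (`X > 0`) and `g → α(α−1)` (`α > 1`), then for
every `δ > 0`, eventually `η ≤ α + δ`: `η` drops below `α + δ` in finite logarithmic time and the
level `α + δ` is a barrier from then on. [folklore] -/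
theorem riccati_eventually_le {α : ℝ} (hα : 1 < α) {η g : ℝ → ℝ} {X : ℝ} (hX : 0 < X)
    (hη : ∀ x, X ≤ x → HasDerivAt η ((η x + g x - η x ^ 2) / x) x)
    (hg : Tendsto g atTop (𝓝 (α * (α - 1)))) {δ : ℝ} (hδ : 0 < δ) :
    ∀ᶠ x in atTop, η x ≤ α + δ := by
  set c : ℝ := δ * (2 * α - 1 + δ) with hc
  have hc0 : 0 < c := mul_pos hδ (by linarith)
  have hg' : ∀ᶠ x in atTop, g x < α * (α - 1) + c / 2 :=
    (tendsto_order.1 hg).2 _ (by linarith)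
  obtain ⟨X₁, hX₁⟩ := eventually_atTop.1 (hg'.and (eventually_ge_atTop X))
  -- quantitative decrease above the level `α + δ`
  have hder : ∀ x, X₁ ≤ x → α + δ ≤ η x → (η x + g x - η x ^ 2) / x ≤ -(c / 2) / x := by
    intro x hx hηx
    obtain ⟨hgx, hXx⟩ := hX₁ x hx
    have hx0 : 0 < x := hX.trans_le hXx
    apply div_le_div_of_nonneg_right _ hx0.le
    have := riccati_field_le hα hδ hηx
    linarith
  -- entry: `η` cannot stay above `α + δ` (it would decrease like `-(c/2) log x`)
  obtain ⟨x₁, hx₁, hηx₁⟩ : ∃ x₁, X₁ ≤ x₁ ∧ η x₁ ≤ α + δ := by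
    by_contra hcon
    push Not at hcon
    have hd : ∀ x, X₁ ≤ x → HasDerivAt (fun x => η x + c / 2 * Real.log x)
        ((η x + g x - η x ^ 2) / x + c / 2 * x⁻¹) x := fun x hx =>
      (hη x (hX₁ x hx).2).add ((Real.hasDerivAt_log (hX.trans_le (hX₁ x hx).2).ne').const_mul _)
    have hanti : AntitoneOn (fun x => η x + c / 2 * Real.log x) (Ici X₁) := by
      refine antitoneOn_of_hasDerivWithinAt_nonpos (convex_Ici X₁)
        (fun x hx => (hd x hx).continuousAt.continuousWithinAt)
        (fun x hx => (hd x (interior_subset hx)).hasDerivWithinAt) fun x hx => ?_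
      rw [interior_Ici] at hx
      have hx' : X₁ ≤ x := le_of_lt hx
      have h1 := hder x hx' (hcon x hx').le
      have hx0 : 0 < x := hX.trans_le (hX₁ x hx').2
      have : -(c / 2) / x + c / 2 * x⁻¹ = 0 := by rw [div_eq_mul_inv]; ring
      linarith
    have hev : ∀ᶠ x in atTop, η X₁ + c / 2 * Real.log X₁ - (α + δ) < c / 2 * Real.log x :=
      (Tendsto.const_mul_atTop (by positivity : 0 < c / 2) Real.tendsto_log_atTop).eventually_gt_atTop
        _
    obtain ⟨x, hx, hxX⟩ := (hev.and (eventually_ge_atTop X₁)).exists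
    have hmono := hanti self_mem_Ici hxX hxX
    have := hcon x hxX
    simp only at hmono
    linarith
  -- barrier: the level `α + δ` is never crossed upwards after `x₁`
  refine eventually_atTop.2 ⟨x₁, fun x hx => ?_⟩
  have hXx₁ : X ≤ x₁ := (hX₁ x₁ hx₁).2
  have key := image_le_of_deriv_right_lt_deriv_boundary (f := η)
    (f' := fun y => (η y + g y - η y ^ 2) / y) (a := x₁) (b := x) (B := fun _ => α + δ)
    (B' := fun _ => 0)
    (fun y hy => (hη y (hXx₁.trans hy.1)).continuousAt.continuousWithinAt)
    (fun y hy => (hη y (hXx₁.trans hy.1)).hasDerivWithinAt)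
    hηx₁ (fun y => hasDerivAt_const y (α + δ))
    (fun y hy hyeq => by
      have h := hder y (hx₁.trans hy.1) hyeq.ge
      have hy0 : 0 < y := hX.trans_le (hX₁ y (hx₁.trans hy.1)).2
      have : -(c / 2) / y < 0 := div_neg_of_neg_of_pos (by linarith) hy0
      show (η y + g y - η y ^ 2) / y < 0
      linarith)
  exact key (right_mem_Icc.2 hx)

/-- **Lower trap.** If moreover `η ≥ 0` on `[X, ∞)`, then for every `0 < δ ≤ α − 1`, eventually
`α − δ ≤ η`: below `α − δ` (and above `0`) the field pushes `η` up at rate `≥ c/x`, so `η` reaches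
the level `α − δ` in finite logarithmic time, and that level is a barrier from then on. [folklore] -/
theorem riccati_eventually_ge {α : ℝ} (hα : 1 < α) {η g : ℝ → ℝ} {X : ℝ} (hX : 0 < X)
    (hη : ∀ x, X ≤ x → HasDerivAt η ((η x + g x - η x ^ 2) / x) x)
    (hpos : ∀ x, X ≤ x → 0 ≤ η x)
    (hg : Tendsto g atTop (𝓝 (α * (α - 1)))) {δ : ℝ} (hδ : 0 < δ) (hδα : δ ≤ α - 1) :
    ∀ᶠ x in atTop, α - δ ≤ η x := by
  set m : ℝ := min (α * (α - 1)) (δ * (2 * α - 1 - δ)) with hm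
  have hm0 : 0 < m := lt_min (by nlinarith) (mul_pos hδ (by linarith))
  have hg' : ∀ᶠ x in atTop, α * (α - 1) - m / 2 < g x := (tendsto_order.1 hg).1 _ (by linarith)
  obtain ⟨X₁, hX₁⟩ := eventually_atTop.1 (hg'.and (eventually_ge_atTop X))
  -- quantitative increase below the level `α - δ`
  have hder : ∀ x, X₁ ≤ x → η x ≤ α - δ → (m / 2) / x ≤ (η x + g x - η x ^ 2) / x := by
    intro x hx hηx
    obtain ⟨hgx, hXx⟩ := hX₁ x hx
    have hx0 : 0 < x := hX.trans_le hXx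
    apply div_le_div_of_nonneg_right _ hx0.le
    have := riccati_field_ge hδα (hpos x hXx) hηx
    linarith
  -- entry: `η` cannot stay below `α - δ` (it would increase like `(m/2) log x`)
  obtain ⟨x₁, hx₁, hηx₁⟩ : ∃ x₁, X₁ ≤ x₁ ∧ α - δ ≤ η x₁ := by
    by_contra hcon
    push Not at hcon
    have hd : ∀ x, X₁ ≤ x → HasDerivAt (fun x => η x - m / 2 * Real.log x)
        ((η x + g x - η x ^ 2) / x - m / 2 * x⁻¹) x := fun x hx =>
      (hη x (hX₁ x hx).2).sub ((Real.hasDerivAt_log (hX.trans_le (hX₁ x hx).2).ne').const_mul _)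
    have hmono : MonotoneOn (fun x => η x - m / 2 * Real.log x) (Ici X₁) := by
      refine monotoneOn_of_hasDerivWithinAt_nonneg (convex_Ici X₁)
        (fun x hx => (hd x hx).continuousAt.continuousWithinAt)
        (fun x hx => (hd x (interior_subset hx)).hasDerivWithinAt) fun x hx => ?_
      rw [interior_Ici] at hx
      have hx' : X₁ ≤ x := le_of_lt hx
      have h1 := hder x hx' (hcon x hx').le
      have hx0 : 0 < x := hX.trans_le (hX₁ x hx').2
      have : (m / 2) / x - m / 2 * x⁻¹ = 0 := by rw [div_eq_mul_inv]; ring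
      linarith
    have hev : ∀ᶠ x in atTop, (α - δ) - (η X₁ - m / 2 * Real.log X₁) < m / 2 * Real.log x :=
      (Tendsto.const_mul_atTop (by positivity : 0 < m / 2) Real.tendsto_log_atTop).eventually_gt_atTop
        _
    obtain ⟨x, hx, hxX⟩ := (hev.and (eventually_ge_atTop X₁)).exists
    have hle := hmono self_mem_Ici hxX hxX
    have := hcon x hxX
    simp only at hle
    linarith
  -- barrier: the level `α - δ` is never crossed downwards after `x₁`
  refine eventually_atTop.2 ⟨x₁, fun x hx => ?_⟩
  have hXx₁ : X ≤ x₁ := (hX₁ x₁ hx₁).2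
  have key := image_le_of_deriv_right_lt_deriv_boundary (f := fun y => -η y)
    (f' := fun y => -((η y + g y - η y ^ 2) / y)) (a := x₁) (b := x) (B := fun _ => -(α - δ))
    (B' := fun _ => 0)
    (fun y hy => (hη y (hXx₁.trans hy.1)).neg.continuousAt.continuousWithinAt)
    (fun y hy => (hη y (hXx₁.trans hy.1)).neg.hasDerivWithinAt)
    (neg_le_neg hηx₁) (fun y => hasDerivAt_const y (-(α - δ)))
    (fun y hy hyeq => by
      have hyeq' : η y = α - δ := by linarith
      have h := hder y (hx₁.trans hy.1) hyeq'.le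
      have hy0 : 0 < y := hX.trans_le (hX₁ y (hx₁.trans hy.1)).2
      have : 0 < (m / 2) / y := div_pos (by linarith) hy0
      show -((η y + g y - η y ^ 2) / y) < 0
      linarith)
  have h := key (right_mem_Icc.2 hx)
  linarith

/-- **The Riccati trap.** Let `α > 1` and let `η` solve `x η' = η + g − η²` on `[X, ∞)` (`X > 0`)
with `η ≥ 0` there and `g → α(α − 1)`.  Then `η → α` (the attracting root of
`η − η² + α(α−1) = −(η − α)(η + α − 1)`). [folklore] -/
theorem riccati_trap {α : ℝ} (hα : 1 < α) {η g : ℝ → ℝ} {X : ℝ} (hX : 0 < X)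
    (hη : ∀ x, X ≤ x → HasDerivAt η ((η x + g x - η x ^ 2) / x) x)
    (hpos : ∀ x, X ≤ x → 0 ≤ η x)
    (hg : Tendsto g atTop (𝓝 (α * (α - 1)))) : Tendsto η atTop (𝓝 α) := by
  refine tendsto_order.2 ⟨fun a ha => ?_, fun b hb => ?_⟩
  · have hδ : 0 < min ((α - a) / 2) (α - 1) := lt_min (by linarith) (by linarith)
    filter_upwards [riccati_eventually_ge hα hX hη hpos hg hδ (min_le_right _ _)] with x hx
    have : min ((α - a) / 2) (α - 1) ≤ (α - a) / 2 := min_le_left _ _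
    linarith
  · have hδ : 0 < (b - α) / 2 := by linarith
    filter_upwards [riccati_eventually_le hα hX hη hg hδ] with x hx
    linarith


/-- **Dominant seed.** Let `V ≥ 0` be continuous with `x² V(x) → α(α − 1)`, `α > 1`.  Then
`v'' = V v` has a global zero-free solution which is dominant at `+∞`: `x v'(x)/v(x) → α`
(the solution with `v(1) = 1`, `v'(1) = 0`; `v² ≥ 1` since `(v v')' = v'² + V v² ≥ 0`).
[folklore] -/
theorem exists_dominant_seed {V : ℝ → ℝ} (hV : Continuous V) (hV0 : ∀ x, 0 ≤ V x) {α : ℝ}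
    (hα : 1 < α) (hVlim : Tendsto (fun x => x ^ 2 * V x) atTop (𝓝 (α * (α - 1)))) :
    ∃ v : ℝ → ℝ, IsSchrodingerSol V v ∧ (∀ x, v x ≠ 0) ∧
      Tendsto (fun x => x * (deriv v x / v x)) atTop (𝓝 α) := by
  obtain ⟨v, hv, hv1, hv1'⟩ := exists_isSchrodingerSol hV 1 1 0
  -- `p = v v'` is nondecreasing (`p' = v'² + V v² ≥ 0`) and vanishes at `1`
  have hp : ∀ x, HasDerivAt (fun x => v x * deriv v x)
      (deriv v x * deriv v x + v x * (V x * v x)) x :=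
    fun x => (hv.hasDerivAt x).fun_mul (hv.hasDerivAt_deriv x)
  have hpmono : Monotone fun x => v x * deriv v x := by
    refine monotone_of_deriv_nonneg (fun x => (hp x).differentiableAt) fun x => ?_
    rw [(hp x).deriv]
    nlinarith [hV0 x, sq_nonneg (deriv v x), sq_nonneg (v x)]
  have hp1 : v 1 * deriv v 1 = 0 := by rw [hv1']; ring
  -- `q = v²` (`q' = 2 p`) is monotone away from `1`, so `q ≥ q 1 = 1`
  have hq : ∀ x, HasDerivAt (fun x => v x * v x) (deriv v x * v x + v x * deriv v x) x :=
    fun x => (hv.hasDerivAt x).fun_mul (hv.hasDerivAt x)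
  have hq1 : ∀ x, 1 ≤ v x * v x := by
    intro x
    rcases le_total 1 x with h | h
    · have hmono : MonotoneOn (fun x => v x * v x) (Ici 1) :=
        monotoneOn_of_hasDerivWithinAt_nonneg (convex_Ici 1)
          (fun y _ => (hq y).continuousAt.continuousWithinAt)
          (fun y _ => (hq y).hasDerivWithinAt) fun y hy => by
            rw [interior_Ici] at hy
            have h2 : v 1 * deriv v 1 ≤ v y * deriv v y := hpmono (le_of_lt hy)
            linarith
      have h3 := hmono self_mem_Ici h h
      simp only [hv1, mul_one] at h3
      exact h3
    · have hanti : AntitoneOn (fun x => v x * v x) (Iic 1) :=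
        antitoneOn_of_hasDerivWithinAt_nonpos (convex_Iic 1)
          (fun y _ => (hq y).continuousAt.continuousWithinAt)
          (fun y _ => (hq y).hasDerivWithinAt) fun y hy => by
            rw [interior_Iic] at hy
            have h2 : v y * deriv v y ≤ v 1 * deriv v 1 := hpmono (le_of_lt hy)
            linarith
      have h3 := hanti h self_mem_Iic h
      simp only [hv1, mul_one] at h3
      exact h3
  have hv0 : ∀ x, v x ≠ 0 := fun x h => by have := hq1 x; rw [h, mul_zero] at this; linarith
  -- the logarithmic derivative `η = x v'/v` solves the radial Riccati equation on `[1, ∞)`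
  have hη : ∀ x, 1 ≤ x → HasDerivAt (fun x => x * (deriv v x / v x))
      ((x * (deriv v x / v x) + x ^ 2 * V x - (x * (deriv v x / v x)) ^ 2) / x) x := by
    intro x hx
    have h := (hasDerivAt_id' x).fun_mul
      ((hv.hasDerivAt_deriv x).fun_div (hv.hasDerivAt x) (hv0 x))
    refine h.congr_deriv ?_
    have hx0 : x ≠ 0 := by positivity
    have hvx := hv0 x
    field_simp
    ring
  have hηpos : ∀ x, 1 ≤ x → 0 ≤ x * (deriv v x / v x) := by
    intro x hx
    have h1 : v 1 * deriv v 1 ≤ v x * deriv v x := hpmono hx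
    rw [hp1] at h1
    rw [← mul_div_mul_left (deriv v x) (v x) (hv0 x)]
    exact mul_nonneg (by linarith) (div_nonneg h1 (by linarith [hq1 x]))
  exact ⟨v, hv, hv0, riccati_trap (g := fun x => x ^ 2 * V x) hα one_pos hη hηpos hVlim⟩

/-- **Dominant seed, registered form** (sub-goal `ladderExists_dominantSeed` of
`stub_ladderExists`): for `V ≥ 0` continuous with `x² V(x) → α(α − 1)`, `α > 1`, the equation
`v'' = V v` has a global zero-free solution with `x v'/v → α`. [folklore] -/
theorem ladderExists_dominantSeed : ∀ (V : ℝ → ℝ) (α : ℝ), Continuous V → (∀ x, 0 ≤ V x) →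
    1 < α → Filter.Tendsto (fun x => x ^ 2 * V x) Filter.atTop (nhds (α * (α - 1))) →
    ∃ v : ℝ → ℝ, Literature.Analysis.ODE.IsSchrodingerSol V v ∧ (∀ x, v x ≠ 0) ∧
      Filter.Tendsto (fun x => x * (deriv v x / v x)) Filter.atTop (nhds α) :=
  fun _ _ hV hV0 hα hlim => exists_dominant_seed hV hV0 hα hlim

end Summit.FinalStateConjecture.FinalStateConjecture.Theorems.CrumPeelingRecessiveTower
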